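import Mathlib
import Literature.Analysis.FluidPDE.Tao2016AveragedNS.ShiftSetCascadeFlows
import Literature.Analysis.ODE.ElementaryFieldDoubletonChainCertificateFast
import Summits.NavierStokesRegularity.NavierStokesRegularity.Theorems.TaoLadderRungTwoFlatCertificateGlueFlowTubeOn
import Summits.NavierStokesRegularity.NavierStokesRegularity.Theorems.TaoLadderRungTwoFlatCertificateGlueClaimStepOn
import Summits.NavierStokesRegularity.NavierStokesRegularity.Theorems.TaoLadderRungTwoFlatCertificateGlueLohnerCascadeOn
import HarnessLib

/-!
# Certificate glue on a shift set `𝕊`, XX-c: THE TREE'S DOUBLETON CHAIN VERIFIER WITH HULLS — `StepCert` from a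
  CHECKED `EDChainCert` (fast test `checkS`) using its a priori enclosures as the step hull and its final doubleton
  as the landing set, inputs by the per-component Grönwall allowance of glue XIV-c
  (helper for items stmt-NavierStokesRegularity-22987 `FlatGapCertificatesV2` (crux K_A♭ of route TaoLadderRungTwoFlat)
  and stmt-24295 K_A₂(64); cell harvest/h2-tao-ladder, p1 g15; referee findings A-66 (β), (γ))

Glue XX (`stepCert_of_claim`) consumes only the CLAIM of the tree's verifiers (existence on `[0,T]` and
`y(T) ∈ final box`) and takes the step hull from the S1 majorant — an origin-centred weighted ball, useless on readout
steps (referee c57 A-66 (β)), and it lands in a BOX (re-boxing at every step boundary, A-66 (γ)). The chain soundness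
theorem of the tree (`Literature.Analysis.ODE.EDChainCert.soundS`, Mrozek–Zgliczyński doubleton chains decided by the
fast test `checkS`) proves more: every solution from the start doubleton stays in the stage's A PRIORI BOX on each mesh
interval and passes through every node's DOUBLETON SET. `stepCert_of_chainCert` feeds exactly this into glue XIV-c
(`stepCert_of_flowTube`):

* `Start z` ⟺ `xcoordC z ∈ 𝒟₀(r₀)` for some `r₀ ∈ [R⁰]` (node `0` of the transcript, per-shell coordinate weights `ωe`
  as in glue XXI's code list); `Tube u p` ⟺ `xcoordC p ∈ apriori_l` for the stage `l` whose mesh interval contains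
  `u` (`exists_mesh_interval`); `Land p` ⟺ `xcoordC p ∈ 𝒟_N(r₀)`;
* the Grönwall allowance `A·ω i k` uses an INDEPENDENT per-component weight table `ω` (glue XIV-c);
* ⇒ `StepCert j` with `Hull j ⊇ ⋃_l (apriori_l ⊕ A·ω)` and `Node (j+1) ⊇ 𝒟_N ⊕ A·ω`;
* `dset_handover` — the allowance is absorbed by the next transcript's start node WITHOUT re-boxing when it repeats
  centre and `C` with `B = 1` and a fattened error box (the shape of the ival_tb2 sets `c + M[−1,1]ⁿ + E`).

What a certificate then consists of: per step one `EDChainCert` accepted by `checkS` (kernel `decide` /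
`native_decide`), the box comparisons `apriori_l ⊆ G`, `apriori_l ⊕ A·ω ⊆` open `M`-box resp. the readout clauses,
the start inclusion, `K`/`δ` from the table sums (glue XV per component) and `gronwallBound 0 K δ h ≤ A`.

HONEST FRAMING: Tao-type MODEL lattices (Tao 2016 §4/§6 vocabulary, shift-set parametrised); the transcript and all
box comparisons are HYPOTHESES — no certificate instance exists in the tree, nothing is computed or certified here,
no stub is closed, nothing here is a statement about the Navier–Stokes equations.
-/

noncomputable section

-- the sub-problem namespace repeats the summit name by design (D-0017)
set_option linter.dupNamespace false

namespace Summit.NavierStokesRegularity.NavierStokesRegularity.Theorems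

open Set Filter Topology Literature.Analysis.FluidPDE Literature.Analysis.FluidPDE.TaoCascade

namespace CertificateGlueOn

variable {m : ℕ} {Kb Ka : ℤ} {ω : Fin m → ℤ → ℝ}

/-! ### `StepCert` from a checked doubleton chain certificate of the tree's fast verifier, WITH HULLS -/

section ChainCert

open Literature.Analysis.ODE Literature.Analysis.ODE.FExpr

variable {𝕊 : Finset (ℤ × ℤ × ℤ)} {ε₀ : ℝ} {α : Fin m → Fin m → Fin m → ℤ × ℤ × ℤ → ℝ} {Eb Et : ℝ}
  {ωe : ℤ → ℝ}

/-- Covering of `[0, τ N]` by the mesh intervals `[τ l, τ (l+1)]`, `l < N`, for ANY `τ` with `τ 0 = 0` (no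
monotonicity needed: take the last index `l < N` with `τ l ≤ u`). [folklore] -/
theorem exists_mesh_interval (τ : ℕ → ℝ) {N : ℕ} (hτ0 : τ 0 = 0) (hN : 0 < N) {u : ℝ} (hu0 : 0 ≤ u)
    (huN : u ≤ τ N) : ∃ l, l < N ∧ τ l ≤ u ∧ u ≤ τ (l + 1) := by
  classical
  set l := Nat.findGreatest (fun l => τ l ≤ u) (N - 1) with hl
  have hlP : τ l ≤ u := Nat.findGreatest_spec (P := fun l => τ l ≤ u) (Nat.zero_le (N - 1)) (by rw [hτ0]; exact hu0)
  have hlN : l ≤ N - 1 := Nat.findGreatest_le (N - 1)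
  refine ⟨l, by omega, hlP, ?_⟩
  rcases Nat.lt_or_ge (l + 1) N with h | h
  · have := Nat.findGreatest_is_greatest (P := fun l => τ l ≤ u) (Nat.lt_succ_self l) (by omega)
    push Not at this
    exact this.le
  · have : l + 1 = N := by omega
    rw [this]; exact huN

/-- **`StepCert` FROM A CHECKED DOUBLETON CHAIN CERTIFICATE (tree verifier, fast test) WITH ITS A PRIORI HULLS.**
Data: a doubleton chain certificate `c` (`Literature.Analysis.ODE.EDChainCert`, the `C¹`-Lohner transcript format of
the tree's kernel ODE verifiers) for a code list evaluating to the truncated window field in the per-shell weighted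
coordinates `x = xcoordC Kb Ka ωe z` (glue XXI supplies such code lists), accepted by the fast chain test
`c.checkS = true`, whose mesh sums to the step length. Then glue XIV-c applies with: `Start` = the doubleton set of
node `0` (over `r₀ ∈ [R⁰]`), `Tube u` = the a priori box of the stage containing `u` (soundness `EDChainCert.soundS`:
existence on the step and, for every solution, the stage enclosures and the node hand-overs), `Land` = the final
doubleton set; the Grönwall allowance is measured with INDEPENDENT per-component weights `ω`. Conclusion: `StepCert j`
with `Hull j ⊇ ⋃_l (apriori_l ⊕ A·ω)` and `Node (j+1) ⊇ (final doubleton) ⊕ A·ω` — hulls as tight as the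
integrator's rough enclosures (referee A-66 (β)), landing in the doubleton itself (no re-boxing, A-66 (γ)).
[cite: MrozekZgliczynski2000, Lemma 8.5 (doubleton chains)] [cite: Moore1979, §8.1 eq. (8.13)] -/
theorem stepCert_of_chainCert (hKb : 0 ≤ Kb) (hKa : 1 ≤ Ka) (hωe : ∀ k, 0 < ωe k) (hω : ∀ i k, 0 < ω i k)
    {M : ℤ → ℝ} {t : ℕ → ℝ} {Node Hull : ℕ → (Fin m → ℤ → ℝ) → Prop} {j : ℕ}
    {c : EDChainCert (m * winLen Kb Ka)} (hc : c.checkS = true)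
    (hfld : ∀ x : Fin (m * winLen Kb Ka) → ℝ, fieldFun c.field x = QcN 𝕊 ε₀ α Kb Ka ωe x x)
    (hT : c.toHOEChain.mesh c.size = t (j + 1) - t j)
    {glo ghi : Fin m → ℤ → ℝ} {K δ A : ℝ} (hK : 0 ≤ K) (hδ : 0 ≤ δ)
    (hN : ∀ y, Node j y → ∃ r₀ ∈ boxSet (castBox c.r0), xcoordC Kb Ka ωe y ∈ (c.nodeAt 0).dset r₀)
    (hGM : ∀ i k, -Kb ≤ k → k ≤ Ka → glo i k ≤ -M k ∧ M k ≤ ghi i k)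
    (hG : ∀ l, l < c.size → ∀ p : Fin m → ℤ → ℝ,
      xcoordC Kb Ka ωe p ∈ boxSet (castBox (c.stageAt l).apriori) → InBoxOn Kb Ka glo ghi p)
    (hlip : PFieldLipOn 𝕊 ε₀ α Kb Ka ω glo ghi K) (hdef : PInputDefectOn 𝕊 ε₀ α Kb Ka Eb Et ω glo ghi δ)
    (hA : gronwallBound 0 K δ (t (j + 1) - t j) ≤ A)
    (hH : ∀ l, l < c.size → ∀ y p : Fin m → ℤ → ℝ,
      xcoordC Kb Ka ωe p ∈ boxSet (castBox (c.stageAt l).apriori) →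
      (∀ i k, -Kb ≤ k → k ≤ Ka → |y i k - p i k| ≤ A * ω i k) → Hull j y)
    (hN' : ∀ y p : Fin m → ℤ → ℝ, ∀ r₀ ∈ boxSet (castBox c.r0), xcoordC Kb Ka ωe p ∈ c.final.dset r₀ →
      (∀ i k, -Kb ≤ k → k ≤ Ka → |y i k - p i k| ≤ A * ω i k) → Node (j + 1) y) :
    StepCert 𝕊 ε₀ α Kb Ka Eb Et M t Node Hull j := by
  have hKK : 0 ≤ Ka + Kb + 1 := by omega
  -- a step of length `≤ 0` is certified vacuously
  rcases le_or_gt (t (j + 1) - t j) 0 with hle | hpos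
  · intro s S hs hsh _ _ _
    exfalso
    exact absurd (hs.trans_le (hsh.trans hle)) (lt_irrefl 0)
  have hN0 : 0 < c.size := by
    rcases Nat.eq_zero_or_pos c.size with h0 | h0
    · exfalso
      have : c.toHOEChain.mesh c.size = 0 := by rw [h0]; exact HOEChainCert.mesh_zero
      rw [hT] at this
      exact absurd this hpos.ne'
    · exact h0
  have hfin : c.nodeAt c.size = c.final := by
    rw [EDChainCert.nodeAt, List.getD_eq_default _ _ (by simp [EDChainCert.size])]
  refine stepCert_of_flowTube
    (Start := fun z => ∃ r₀ ∈ boxSet (castBox c.r0), xcoordC Kb Ka ωe z ∈ (c.nodeAt 0).dset r₀)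
    (Land := fun p => ∃ r₀ ∈ boxSet (castBox c.r0), xcoordC Kb Ka ωe p ∈ c.final.dset r₀)
    (Tube := fun u p => ∃ l, l < c.size ∧ c.toHOEChain.mesh l ≤ u ∧ u ≤ c.toHOEChain.mesh (l + 1) ∧
      xcoordC Kb Ka ωe p ∈ boxSet (castBox (c.stageAt l).apriori))
    hKb hKa hω hK hδ hN hGM (fun u _ p hp => ?_) hlip hdef (fun z hz => ?_) hA
    (fun u _ y p hp hnear => ?_) (fun y p hp hnear => ?_)
  · obtain ⟨l, hl, -, -, hp⟩ := hp
    exact hG l hl p hp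
  · -- the exact flow from a start state: the chain's own solution, as a cascade family
    obtain ⟨r₀, hr₀, hz⟩ := hz
    obtain ⟨y, hy0, hyd⟩ := (EDChainCert.soundS hc hr₀ hz).1
    obtain ⟨hnodes, hhulls⟩ := (EDChainCert.soundS hc hr₀ hz).2 y hy0 hyd
    -- coordinates of the cascade family built from `y u` are `y u`
    have hxc : ∀ u, xcoordC Kb Ka ωe (wstate Kb Ka ωe ((y u) ∘ finProdFinEquiv)) = y u := by
      intro u
      funext d
      simp only [xcoordC, wcoord_wstate hωe hKK, Function.comp_apply, Equiv.apply_symm_apply]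
    refine ⟨fun i k u => wstate Kb Ka ωe ((y u) ∘ finProdFinEquiv) i k, fun i k hk1 hk2 => ?_,
      fun i k hk1 hk2 u hu => ?_, fun u hu => ?_, ?_⟩
    · -- start
      show wstate Kb Ka ωe ((y 0) ∘ finProdFinEquiv) i k = z i k
      rw [hy0, xcoordC_comp, wstate_wcoord hωe z i hk1 hk2]
    · -- the window equation (as in glue XIX)
      have hlt : (k + Kb).toNat < winLen Kb Ka := by
        unfold winLen; rw [Int.toNat_lt_toNat (by omega)]; omega
      set cc : Fin (winLen Kb Ka) := ⟨(k + Kb).toNat, hlt⟩ with hcc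
      have hsh : shellAt Kb cc = k := by
        simp only [shellAt, hcc]; rw [Int.toNat_of_nonneg (by omega)]; ring
      have hfun : (fun u => wstate Kb Ka ωe ((y u) ∘ finProdFinEquiv) i k) =
          fun u => ωe k * y u (finProdFinEquiv (i, cc)) := by
        funext u
        have := wstate_on (ω := ωe) ((y u) ∘ finProdFinEquiv) hKK i cc
        rw [hsh] at this
        simpa using this
      dsimp only
      rw [hfun]
      have hu' : u ∈ Icc (0 : ℝ) (c.toHOEChain.mesh c.size) := by rw [hT]; exact hu
      have hd := (hasDerivWithinAt_pi.1 (hyd u hu') (finProdFinEquiv (i, cc))).const_mul (ωe k)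
      rw [hT] at hd
      refine hd.congr_deriv ?_
      have hslice : slice (fun i k u => wstate Kb Ka ωe ((y u) ∘ finProdFinEquiv) i k) u =
          wstate Kb Ka ωe ((y u) ∘ finProdFinEquiv) := by
        funext i' k'; rfl
      rw [hslice, truncField_eq_biFieldOn, hfld]
      have hQapp : QcN 𝕊 ε₀ α Kb Ka ωe (y u) (y u) (finProdFinEquiv (i, cc)) =
          biFieldOn 𝕊 ε₀ α Kb Ka (wstate Kb Ka ωe ((y u) ∘ finProdFinEquiv))
            (wstate Kb Ka ωe ((y u) ∘ finProdFinEquiv)) i k / ωe k := by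
        simp only [QcN, Qc, Equiv.symm_apply_apply, wcoord]
        rw [hsh]
      rw [hQapp]
      field_simp [(hωe k).ne']
    · -- the tube: the a priori box of the stage containing `u`
      have hu' : u ≤ c.toHOEChain.mesh c.size := by rw [hT]; exact hu.2
      obtain ⟨l, hl, hl1, hl2⟩ :=
        exists_mesh_interval c.toHOEChain.mesh HOEChainCert.mesh_zero hN0 hu.1 hu'
      refine ⟨l, hl, hl1, hl2, ?_⟩
      have hsl : slice (fun i k u => wstate Kb Ka ωe ((y u) ∘ finProdFinEquiv) i k) u =
          wstate Kb Ka ωe ((y u) ∘ finProdFinEquiv) := by funext i' k'; rfl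
      rw [hsl, hxc u]
      exact hhulls l hl u ⟨hl1, hl2⟩
    · -- landing in the final doubleton
      refine ⟨r₀, hr₀, ?_⟩
      have hsl : slice (fun i k u => wstate Kb Ka ωe ((y u) ∘ finProdFinEquiv) i k) (t (j + 1) - t j) =
          wstate Kb Ka ωe ((y (t (j + 1) - t j)) ∘ finProdFinEquiv) := by funext i' k'; rfl
      rw [hsl, hxc, ← hfin, ← hT]
      exact hnodes c.size le_rfl
  · obtain ⟨l, hl, -, -, hp'⟩ := hp
    exact hH l hl y p hp' hnear
  · obtain ⟨r₀, hr₀, hp'⟩ := hp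
    exact hN' y p r₀ hr₀ hp' hnear

/-- **DOUBLETON HAND-OVER ACROSS A STEP BOUNDARY (no re-boxing)**: if the landing node `ν` and the next start node
`ν'` have the same centre and the same point matrix `C`, both have `B = 1`, and the error box of `ν'` contains the
error box of `ν` fattened componentwise by `a` (`[R'] ⊇ [R] + [−a, a]`), then every point within `a` (componentwise)
of the doubleton set `𝒟_ν(r₀)` lies in `𝒟_{ν'}(r₀)` — the per-component Grönwall allowance of glue XIV-c / XX-c is
absorbed into the remainder part, exactly like `inPara_of_near` (glue XIX) for parallelepipeds.
[cite: MrozekZgliczynski2000, Lemma 8.5 (doubleton representation)] [cite: Moore1979, §8.1 pp. 97–99 (the wrapping effect)] -/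
theorem dset_handover {n : ℕ} {ν ν' : DNode n} (hc : ν'.center = ν.center) (hC : ν'.cmat = ν.cmat)
    (hB : isOneQ ν.bmat = true) (hB' : isOneQ ν'.bmat = true) {a : Fin n → ℝ}
    (hrem : ∀ r : Fin n → ℝ, r ∈ boxSet (castBox ν.rem) → ∀ e : Fin n → ℝ, (∀ d, |e d| ≤ a d) →
      r + e ∈ boxSet (castBox ν'.rem))
    {r₀ x x' : Fin n → ℝ} (hx : x ∈ ν.dset r₀) (hnear : ∀ d, |x' d - x d| ≤ a d) : x' ∈ ν'.dset r₀ := by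
  obtain ⟨r, hr, hxr⟩ := hx
  refine ⟨r + (x' - x), hrem r hr (x' - x) (fun d => by simpa using hnear d), ?_⟩
  have h1 : ν'.centerVec = ν.centerVec := by
    funext l; simp [DNode.centerVec, hc]
  rw [h1, hC, eq_one_of_isOneQ hB', castQMat_one, Matrix.one_mulVec]
  rw [eq_one_of_isOneQ hB, castQMat_one, Matrix.one_mulVec] at hxr
  rw [hxr]
  abel

end ChainCert

end CertificateGlueOn

end Summit.NavierStokesRegularity.NavierStokesRegularity.Theorems

end
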